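import Mathlib.Topology.Instances.AddCircle.Real
import Mathlib.Analysis.Normed.Group.AddCircle
import Mathlib.Combinatorics.Pigeonhole
import Mathlib.Data.Real.Basic
import Mathlib.Tactic
import HarnessLib

/-!
# Route `GreenTaoLevelTwo`, crux `GITwo` (stmt-Parity-21275), line `birth`, stub `stub_cyclicInverse`:
# Bohr sets in `ℤ/Nℤ` are large (GT08a arXiv Lemma 35, lower bound)

Eleventh helper file toward the XL stub `stub_cyclicInverse` (B. Green, T. Tao, *An inverse theorem
for the Gowers `U³(G)` norm*, arXiv:math/0503014, Thm. 68 = PEMS 51 (2008) Thm. 12.8).  Blocks B–D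
of the printed proof live on **Bohr sets** `B(S, ρ) = {x : ‖ξ·x/N‖_{ℝ/ℤ} < ρ ∀ ξ ∈ S}` of `ℤ/Nℤ`
(arXiv Def. 15).  The tree has no Bohr-set vocabulary yet; pending a reviewed definition file, this
def-free helper states Bohr sets INLINE through Mathlib's `ZMod.toAddCircle : ℤ/Nℤ →+ ℝ/ℤ`
(`‖ZMod.toAddCircle (x * ξ)‖ < ρ`) and lands the pigeonhole lower bound of arXiv Lemma 35 in the
form `#B(S, 1/L) ≥ N / L^{#S}` (`L ≥ 1` an integer; for `ρ ∈ (0,1]` take `L = ⌈1/ρ⌉ ≤ 2/ρ`, giving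
`#B(S,ρ) ≥ (ρ/2)^d N`):

* `norm_toAddCircle_sub_le` — `‖toAddCircle(v) − toAddCircle(w)‖ ≤ |val v − val w| / N`;
* `abs_sub_lt_of_div_eq` — equal box indices `⌊val·L/N⌋` force `|val v − val w| < N/L`;
* `card_bohr_ge` — **arXiv Lemma 35 (lower bound)**: `(N : ℝ) / L^{#S} ≤ #B(S, 1/L)`, by the
  pigeonhole principle on the `L^{#S}` boxes of `(ℝ/ℤ)^S` and the translation `x ↦ x − x₀`.

Next (not here): the doubling bound `#B(S,2ρ) ≤ 4^d #B(S,ρ)`, regular Bohr sets (arXiv Lemma 36),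
the separation lemma (arXiv Lemma 37).

References: [GreenTao2008U3Inverse] arXiv:math/0503014, Def. 15 and Lemma 35; T. Tao, V. Vu,
*Additive Combinatorics*, Lemma 4.20.
-/

namespace Summit.Parity.GeneralizedHardyLittlewood.GreenTaoLevelTwoGITwoCyclicInverse

open Finset

variable {N : ℕ} [NeZero N]

/-- Distances in `ℝ/ℤ` between images of residues are controlled by their representatives:
`‖toAddCircle v − toAddCircle w‖ ≤ |val v − val w| / N`. [folklore] -/
theorem norm_toAddCircle_sub_le (v w : ZMod N) :
    ‖ZMod.toAddCircle v - ZMod.toAddCircle w‖ ≤ |((v.val : ℝ) - w.val)| / N := by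
  have hN : (0 : ℝ) < N := by exact_mod_cast Nat.pos_of_ne_zero (NeZero.ne N)
  rw [ZMod.toAddCircle_apply, ZMod.toAddCircle_apply, ← AddCircle.coe_sub, UnitAddCircle.norm_eq]
  have h := round_le ((v.val : ℝ) / N - (w.val : ℝ) / N) 0
  rw [Int.cast_zero, sub_zero] at h
  refine h.trans (le_of_eq ?_)
  rw [← sub_div, abs_div, abs_of_pos hN]

/-- Equal box indices: if `⌊a L / N⌋ = ⌊b L / N⌋` for naturals `a, b` then `|a − b| · L < N`.
[folklore] -/
theorem abs_sub_mul_lt_of_div_eq {a b L : ℕ} (h : a * L / N = b * L / N) :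
    |((a : ℝ) - b)| * L < N := by
  have hN : 0 < N := Nat.pos_of_ne_zero (NeZero.ne N)
  -- `q N ≤ a L < (q+1) N` and the same for `b`
  have ha1 := Nat.div_mul_le_self (a * L) N
  have ha2 := Nat.lt_div_mul_add (a := a * L) hN
  have hb1 := Nat.div_mul_le_self (b * L) N
  have hb2 := Nat.lt_div_mul_add (a := b * L) hN
  rw [h] at ha1 ha2
  set q := b * L / N with hq
  -- now `|aL - bL| < N` as naturals, then cast
  have key : ((a : ℝ) - b) * L < N ∧ ((b : ℝ) - a) * L < N := by
    constructor
    · have : (a * L : ℝ) < q * N + N := by exact_mod_cast ha2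
      have : (q * N : ℝ) ≤ b * L := by exact_mod_cast hb1
      nlinarith
    · have : (b * L : ℝ) < q * N + N := by exact_mod_cast hb2
      have : (q * N : ℝ) ≤ a * L := by exact_mod_cast ha1
      nlinarith
  rcases le_or_gt (b : ℝ) a with hab | hab
  · rw [abs_of_nonneg (by linarith)]; exact key.1
  · rw [abs_of_neg (by linarith), neg_sub]; exact key.2

/-- **Bohr sets are large (GT08a arXiv Lemma 35, lower bound).**  For `S ⊆ ℤ/Nℤ` and an integer
`L ≥ 1`, the Bohr set `B(S, 1/L) = {x : ‖ξx/N‖_{ℝ/ℤ} < 1/L ∀ ξ ∈ S}` has at least `N / L^{#S}`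
elements. [cite: GreenTao2008U3Inverse, Lemma 35] -/
theorem card_bohr_ge (S : Finset (ZMod N)) {L : ℕ} (hL : 0 < L) :
    (N : ℝ) / (L : ℝ) ^ #S ≤
      #{x : ZMod N | ∀ ξ ∈ S, ‖ZMod.toAddCircle (x * ξ)‖ < 1 / (L : ℝ)} := by
  classical
  have hN : 0 < N := Nat.pos_of_ne_zero (NeZero.ne N)
  have hNr : (0 : ℝ) < N := by exact_mod_cast hN
  have hLr : (0 : ℝ) < L := by exact_mod_cast hL
  -- the box map
  have hbox : ∀ x : ZMod N, ∀ ξ : ZMod N, (x * ξ).val * L / N < L := by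
    intro x ξ
    rw [Nat.div_lt_iff_lt_mul hN]
    rw [mul_comm L]
    exact Nat.mul_lt_mul_of_pos_right (ZMod.val_lt (x * ξ)) hL
  let box : ZMod N → (↥S → Fin L) := fun x ξ => ⟨(x * (ξ : ZMod N)).val * L / N, hbox x ξ⟩
  have hmaps : ∀ x ∈ (univ : Finset (ZMod N)), box x ∈ (univ : Finset (↥S → Fin L)) :=
    fun _ _ => mem_univ _
  have ht : (univ : Finset (↥S → Fin L)).Nonempty := ⟨fun _ => ⟨0, hL⟩, mem_univ _⟩
  have hcardt : #(univ : Finset (↥S → Fin L)) = L ^ #S := by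
    rw [card_univ, Fintype.card_fun, Fintype.card_fin, Fintype.card_coe]
  have hb : #(univ : Finset (↥S → Fin L)) • ((N : ℝ) / (L : ℝ) ^ #S) ≤ #(univ : Finset (ZMod N)) := by
    rw [hcardt, card_univ, ZMod.card, nsmul_eq_mul]
    push_cast
    rw [mul_div_cancel₀ _ (by positivity)]
  obtain ⟨y, -, hy⟩ := exists_le_card_fiber_of_nsmul_le_card_of_maps_to hmaps ht hb
  -- a point of the large fibre and the translation into the Bohr set
  have hfib_ne : ({x ∈ (univ : Finset (ZMod N)) | box x = y} : Finset (ZMod N)).Nonempty := by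
    rw [← card_pos, ← Nat.cast_pos (α := ℝ)]
    exact lt_of_lt_of_le (by positivity) hy
  obtain ⟨x₀, hx₀⟩ := hfib_ne
  rw [mem_filter] at hx₀
  refine hy.trans ?_
  have hinj : #{x ∈ (univ : Finset (ZMod N)) | box x = y} ≤
      #{x : ZMod N | ∀ ξ ∈ S, ‖ZMod.toAddCircle (x * ξ)‖ < 1 / (L : ℝ)} := by
    refine Finset.card_le_card_of_injOn (fun x => x - x₀) ?_ ?_
    · intro x hx
      rw [mem_coe, mem_filter] at hx
      rw [mem_coe, mem_filter]
      refine ⟨mem_univ _, fun ξ hξ => ?_⟩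
      -- same box for the coordinate `ξ`
      have hsame : (x * ξ).val * L / N = (x₀ * ξ).val * L / N := by
        have h1 := congrFun hx.2 ⟨ξ, hξ⟩
        have h2 := congrFun hx₀.2 ⟨ξ, hξ⟩
        have h3 : box x ⟨ξ, hξ⟩ = box x₀ ⟨ξ, hξ⟩ := h1.trans h2.symm
        exact congrArg Fin.val h3
      have hlt := abs_sub_mul_lt_of_div_eq hsame
      rw [sub_mul, map_sub]
      refine (norm_toAddCircle_sub_le _ _).trans_lt ?_
      rw [div_lt_div_iff₀ hNr hLr, one_mul]
      exact hlt
    · intro x _ x' _ h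
      exact sub_left_injective h
  exact_mod_cast hinj

end Summit.Parity.GeneralizedHardyLittlewood.GreenTaoLevelTwoGITwoCyclicInverse
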